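import Summits.MatrixMultiplication.MatrixMultiplication.Theses.TripartitionBridge
import Literature.Computability.AlgebraicComplexity.TripartitionTensor
import Literature.Computability.AlgebraicComplexity.AsymptoticRankBorderRank
import Literature.Computability.AlgebraicComplexity.TensorRestrictionRank
import Literature.Barriers.MatrixMultiplication.UniversalMethodBarrierAsymptoticRank

/-!
# Crux `TkMinimal` (stmt-MatrixMultiplication-6569) — `Lines/birth.lean`, the BC3 birth skeleton

Route `TripartitionBridge` (route-MatrixMultiplication-TripartitionBridge;
`closes : DUp → TkMinimal → GlueOmega → GlueCW90 → MatrixMultiplication`, proved in the route file).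
The crux, with `T_k = tripartitionTensor ℂ k` (Pratt 2024, Def. 1.4; the Literature def is `rfl`-equal
to the route's inlined term on `TripartitionIndex k = {A : Finset (Fin (3k)) // A.card = k}`):

  `TkMinimal : ∀ δ > 0, ∀ k₀, ∃ k ≥ k₀, R̃(T_k) ≤ (27/4 + δ)^k`

(`lim inf_k R̃(T_k)^{1/k} = 27/4`: the balanced tripartition tensors are asymptotically minimal along a
subsequence — the instance of Strassen's asymptotic rank conjecture the positive assembly needs; the
flattening floor `C(3k,k) ≤ R̃(T_k)` is PROVED in tree, `choose_le_asymptoticRank_tripartitionTensor`,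
and `C(3k,k)^{1/k} → 27/4`).

## The line: W-coordinates (balanced block of `cw₁^{⊠3k}`) + border-rank power milestones

Every construction bearing on `T_k` lives in the coordinates of the `3k`-th Kronecker power of the
`2 × 2 × 2` tensor `W = cwTensor ℂ 1 = e₀e₁e₁ + e₁e₀e₁ + e₁e₁e₀` (structure tensor of `ℂ[x]/(x²)`,
border rank `2`): `T_k` is the block of `W^{⊠3k}` on the `0/1`-vectors with exactly `k` zeros
(Kaski–Michałek arXiv:2404.06427 §3: `T_k = T(g)` is a composition-basis tensor of `W`-powers, `g = k·(011+101+110)`;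
Pratt 2024 §1.2: zeroing of the structure tensor of `ℤ₂^{3k}`; Coppersmith–Winograd's uniquely solvable
puzzles are induced matchings of this block).  This skeleton makes that dictionary the first stub and states
the engine in those coordinates, in the certifiable currency of border-rank milestones of Kronecker powers:

* `stub_balancedBlockDictionary` — **the dictionary** (provable now, size S/M; lemma request (iii) of the
  definition item `tripartitionTensor`, not yet in tree):
  `W^{⊠3k}(𝟙_{Sᶜ}, 𝟙_{Tᶜ}, 𝟙_{Uᶜ}) = [S, T, U pairwise disjoint]` for `k`-subsets `S, T, U ⊆ [3k]`
  (`W(a,b,c) = 1` iff exactly one of `a, b, c` is `0`; three `k`-subsets of `[3k]` are pairwise disjoint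
  iff every point lies in exactly one of them, `TripartitionIndex.disjoint_iff_union_eq_univ`).  It is
  load-bearing: with `tensorRestrictsTo_precomp` it gives `Z_k ≥ T_k`, where
  `Z_k := W^{⊠3k}` zeroed to `V_k = {v : Fin 3k → Fin 2 // #{i | v i = 0} = k}` (in fact `Z_k ≅ T_k`).
* `stub_balancedBlockPowerMilestones` — **the engine** (open; the crux in certifiable currency):
  `∀ δ > 0, ∀ k₀, ∃ k ≥ k₀, ∃ m ≥ 1, bR(Z_k^{⊠m}) ≤ ((27/4 + δ)^k)^m` (algebraic border rank over `ℂ[ε]`,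
  Bläser 2013 Def. 6.1).  Why plausibly true: it is the route's rank-3 bet — every known universal spectral
  point (support/quantum functionals) takes the flattening value `C(3k,k)` at `T_k`, so no known obstruction
  separates `T_k` from `⟨C(3k,k)⟩` asymptotically; it is EQUIVALENT in truth value to the crux (converse by
  `exists_tensorRank_kroneckerPow_lt`, `bR ≤ R`, and the dictionary), but not cheaply (BC3 probes), and every
  instance `(k, m, decomposition)` is a finite certificate.  Why it might fail: the Set Cover Conjecture forbids
  it (Pratt 2024 Cor. 1.11, tree fact `pratt2024_cor_1_11`: `R̃(T_k) > (8−ε)^k` eventually); unconditionally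
  only `R(T_k) ≤ 8^k/2` is known, which settles the milestone for `k ≤ 4` only (`8^k/2 ≤ (27/4)^k` iff `k ≤ 4`);
  the first open instance is `k = 5`: `bR(Z_5^{⊠m})^{1/m} < 14014 ≈ (27/4)^5 (1 + ·)` against `R ≤ 16384`.
  Size XL / open-problem.
* Sorry-free core: `pow_asymptoticRank_le_kroneckerPow` (`R̃(t)^m ≤ R̃(t^{⊠m})`, from the infimum; copied
  from `Cruxes/OctAsymptoticRank/Lines/birth.lean` to keep this workfile free of cross-crux imports) and
  `asymptoticRank_le_of_restrictsTo_of_powMilestone` (ANY `s ≥ t`, any `r ≥ 0`, one milestone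
  `bR(s^{⊠m}) ≤ r^m`, `m ≥ 1` ⇒ `R̃(t) ≤ r`; uses `asymptoticRank_le_of_polyDegeneratesTo`,
  `asymptoticRank_le_algBorderRank`, `le_of_pow_le_pow_left₀`).
* `tkMinimal_statement_of : <stub₁-sig> → <stub₂-sig> → <the crux statement, verbatim>` — the composition as a
  real proof from the two stub STATEMENTS as explicit hypotheses (the complement-indicator relabelling
  `TripartitionIndex k → V_k`, the dictionary as a `funext` identity, `tensorRestrictsTo_precomp`, the core;
  axioms `propext`, `Classical.choice`, `Quot.sound` only); and THE skeleton theorem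
  `TkMinimal_of : TkMinimal := tkMinimal_statement_of stub₁ stub₂` — the crux BY NAME (the only theorem of the
  file concluding it), closed only through the `sorryAx` of the two declared stubs.

Dead sub-line recorded (planner computation, `py/linforce.py` in the planner folder; see `Lines/birth.md`):
RANK bounds through tripartition-faithful embeddings into finite abelian groups (Pratt's `ℤ₂^{3k−1}` remark,
the route header's foreseen split of this crux) cannot beat `8^k/poly(k)`: the tripartition constraints force
the embedding to be affine-linear, and faithfulness then forces distinct subset sums up to size `1.5k − 3`.
So the engine is deliberately stated for BORDER rank of POWERS, not for rank through a group diagonal.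

Disproof used: none exists for this crux (`ledger crux ls stmt-MatrixMultiplication-6569`: no workfiles; no
`Negative/` lemma; nothing on `T_k` in `ledger negatives --problem MatrixMultiplication`), so no
`_false_without_` obligation applies.  Kill inherited from the route: an unconditional
`R̃(T_k) ≥ (27/4 + δ)^k` for all large `k` (a dark spectral point at `T_k`; cf. the sibling item
`FidelityWitnesses.TripartitionDarkness`, open exactly on `0 < ε ≤ 5/4`) refutes stub 2 and the crux together.

BC3 probes (planner-run 2026-08-17, `lean check`, one `example` per tactic among `exact?`, `simpa [X]`,
`unfold X; simpa`, `aesop`, each under `maxHeartbeats 400000`, stub statements restated verbatim, this file NOT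
imported): `stub_balancedBlockDictionary → TkMinimal`, `stub_balancedBlockDictionary → MatrixMultiplication`,
`stub_balancedBlockPowerMilestones → TkMinimal`, `stub_balancedBlockPowerMilestones → MatrixMultiplication` — all
FAIL, as do the converses `TkMinimal → stub` (files `bc/probe_stub1_split.lean`, `bc/probe_stub2_split.lean`,
`bc/probe_converse.lean` in the planner folder; verdicts quoted in `Lines/birth.md`).
-/

-- `Summit.<Summit>.<Problem>`: for the single-conjunct summit the duplicate component is mandated.
set_option linter.dupNamespace false

noncomputable section

namespace Summit.MatrixMultiplication.MatrixMultiplication.Cruxes.TkMinimal.Birth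

open Literature.Computability.AlgebraicComplexity
open Literature.Barriers.MatrixMultiplication (asymptoticRank_le_of_polyDegeneratesTo
  asymptoticRank_le_rpow tensorRank_kroneckerPow_mul)
open Summit.MatrixMultiplication.MatrixMultiplication.Theses.TripartitionBridge (TkMinimal)

/-! ## The two registered stubs -/

/-- **Stub 1 — the dictionary: `T_k` is the balanced block of `W^{⊠3k}`.**  For `k`-subsets
`S, T, U ⊆ [3k]`, the entry of `(cwTensor ℂ 1)^{⊠3k}` at the complement indicators
(`i ↦ 0` on the set, `1` off it) is `1` if `S, T, U` are pairwise disjoint and `0` otherwise: at each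
coordinate `W(a,b,c) = 1` iff exactly one of `a, b, c` is `0`, and three `k`-subsets of a `3k`-set are
pairwise disjoint iff they partition it (`TripartitionIndex.disjoint_iff_union_eq_univ`).  Provable now,
size S/M (a `Finset.prod_eq_one` / `Finset.prod_eq_zero` computation); it is lemma request (iii) of the
definition item `tripartitionTensor`.  Sources: Pratt2024 (§1.2), arXiv:2404.06427 (§3, Ex. 11),
CoppersmithWinograd1990 (§6, uniquely solvable puzzles). -/
theorem stub_balancedBlockDictionary :
    ∀ (k : ℕ) (S T U : {A : Finset (Fin (3 * k)) // A.card = k}),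
      Literature.Computability.AlgebraicComplexity.kroneckerPow
          (Literature.Computability.AlgebraicComplexity.cwTensor ℂ 1) (3 * k)
          (fun i => if i ∈ S.1 then 0 else 1) (fun i => if i ∈ T.1 then 0 else 1)
          (fun i => if i ∈ U.1 then 0 else 1) =
        if Disjoint S.1 T.1 ∧ Disjoint S.1 U.1 ∧ Disjoint T.1 U.1 then (1 : ℂ) else 0 := by
  sorry

/-- **Stub 2 — border-rank power milestones of the balanced block (the engine).**  For every
`δ > 0` and `k₀` there are `k ≥ k₀` and `m ≥ 1` such that the `m`-th Kronecker power of
`Z_k = (cwTensor ℂ 1)^{⊠3k}` zeroed to the `0/1`-vectors with exactly `k` zeros has algebraic border rank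
(over `ℂ[ε]`, Bläser 2013 Def. 6.1) at most `((27/4 + δ)^k)^m`.  The quantifier shape is that of the crux
(`lim inf` over `k`), with one extra existential `m` (certificates of a fixed power).  Why plausibly true:
the route's bet — all known universal spectral points read `C(3k,k) = (27/4)^{k(1−o(1))}` on `T_k ≅ Z_k`;
implied by Strassen's asymptotic rank conjecture for the tight concise `T_k`.  Why it might fail: the Set
Cover Conjecture gives `R̃(T_k) > (8 − ε)^k` eventually (Pratt 2024 Cor. 1.11); known unconditionally:
`R(T_k) ≤ 8^k/2`, enough for `k ≤ 4` only.  Size XL / open-problem.  Sources: Pratt2024, arXiv:2311.02774,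
BjorklundKaski2024, arXiv:2404.06427, Strassen1988, Blaser2013 (Def. 6.1),
BurgisserClausenShokrollahi1997 (Lemma 15.27). -/
theorem stub_balancedBlockPowerMilestones :
    ∀ δ : ℝ, 0 < δ → ∀ k₀ : ℕ, ∃ k : ℕ, k₀ ≤ k ∧ ∃ m : ℕ, 1 ≤ m ∧
      (Literature.Computability.AlgebraicComplexity.algBorderRank
          (Literature.Computability.AlgebraicComplexity.kroneckerPow
            (fun a b c : {v : Fin (3 * k) → Fin 2 //
                (Finset.univ.filter fun i => v i = 0).card = k} =>
              Literature.Computability.AlgebraicComplexity.kroneckerPow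
                (Literature.Computability.AlgebraicComplexity.cwTensor ℂ 1) (3 * k) a.1 b.1 c.1)
            m) : ℝ) ≤
        ((((27 : ℝ) / 4 + δ) ^ k) ^ m) := by
  sorry

/-! ## Sorry-free core -/

/-- **`R̃(t)^k ≤ R̃(t^{⊠k})`** (`k ≥ 1`): from the infimum, `R̃(t) ≤ R(t^{⊠(Nk)})^{1/(Nk)} =
(R((t^{⊠k})^{⊠N})^{1/N})^{1/k}` for every `N ≥ 1` (Christandl–Vrana–Zuiddam 2023, §1.1; same proof as in
`Cruxes/OctAsymptoticRank/Lines/birth.lean`). [folklore] -/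
theorem pow_asymptoticRank_le_kroneckerPow {ι κ μ : Type*} [Fintype ι] [Fintype κ] [Fintype μ]
    (t : ι → κ → μ → ℂ) {k : ℕ} (hk : 0 < k) :
    asymptoticRank t ^ k ≤ asymptoticRank (kroneckerPow t k) := by
  have h0 : 0 ≤ asymptoticRank t := asymptoticRank_nonneg t
  have hk0 : (k : ℝ) ≠ 0 := by exact_mod_cast hk.ne'
  refine le_ciInf fun N => ?_
  have hkN : 0 < (N + 1) * k := Nat.mul_pos (Nat.succ_pos N) hk
  have h1 := asymptoticRank_le_rpow t hkN
  rw [tensorRank_kroneckerPow_mul t (N + 1) k] at h1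
  calc asymptoticRank t ^ k
      ≤ (((tensorRank (kroneckerPow (kroneckerPow t k) (N + 1)) : ℝ)) ^
          ((((N + 1) * k : ℕ) : ℝ))⁻¹) ^ k := pow_le_pow_left₀ h0 h1 k
    _ = (tensorRank (kroneckerPow (kroneckerPow t k) (N + 1)) : ℝ) ^ ((N : ℝ) + 1)⁻¹ := by
        rw [← Real.rpow_natCast, ← Real.rpow_mul (Nat.cast_nonneg _)]
        congr 1
        push_cast
        rw [mul_inv, inv_mul_cancel_right₀ hk0]

/-- **Composition with explicit hypotheses** (the BC3 shape, for ANY tensors and any target `r ≥ 0`):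
if `s` restricts to `t` and ONE Kronecker power `s^{⊠m}`, `m ≥ 1`, has border rank at most `r^m`, then
`R̃(t) ≤ r`.  Proof: `R̃(t) ≤ R̃(s)` (degeneration monotonicity), `R̃(s)^m ≤ R̃(s^{⊠m}) ≤ bR(s^{⊠m}) ≤ r^m`
(BCS Lemma 15.27 `R̃ ≤ bR`), and `m`-th roots.  Sorry-free, standard axioms. [folklore] -/
theorem asymptoticRank_le_of_restrictsTo_of_powMilestone
    {ι κ μ ι' κ' μ' : Type*} [Fintype ι] [Fintype κ] [Fintype μ] [Fintype ι'] [Fintype κ']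
    [Fintype μ'] [DecidableEq ι] [DecidableEq κ] [DecidableEq μ] [DecidableEq ι'] [DecidableEq κ']
    [DecidableEq μ'] {s : ι → κ → μ → ℂ} {t : ι' → κ' → μ' → ℂ}
    (hst : TensorRestrictsTo s t) {r : ℝ} (hr : 0 ≤ r) {m : ℕ} (hm : 1 ≤ m)
    (hbR : (algBorderRank (kroneckerPow s m) : ℝ) ≤ r ^ m) :
    asymptoticRank t ≤ r := by
  -- `R̃(t) ≤ R̃(s)`: a restriction is a degeneration and `R̃` is monotone under degeneration
  have hts : asymptoticRank t ≤ asymptoticRank s :=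
    asymptoticRank_le_of_polyDegeneratesTo hst.polyDegeneratesTo
  refine hts.trans ?_
  have hm0 : 0 < m := hm
  have h1 : asymptoticRank s ^ m ≤ r ^ m :=
    calc asymptoticRank s ^ m ≤ asymptoticRank (kroneckerPow s m) :=
          pow_asymptoticRank_le_kroneckerPow s hm0
      _ ≤ algBorderRank (kroneckerPow s m) := asymptoticRank_le_algBorderRank _
      _ ≤ r ^ m := hbR
  exact le_of_pow_le_pow_left₀ hm0.ne' hr h1

/-! ## The composition: the two stubs prove the crux BY NAME -/

/-- **The composition from the two stub STATEMENTS as explicit hypotheses**, concluding the statement of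
the crux `TkMinimal` written out verbatim (so that `TkMinimal_of` below is the file's only theorem concluding
the crux by name): given `δ, k₀`, the engine supplies `k ≥ k₀`, `m ≥ 1` and the milestone for `Z_k^{⊠m}`; the
dictionary rewrites the route's `T_k` as `Z_k` pulled back along the complement-indicator map `S ↦ 𝟙_{Sᶜ}`
(a restriction, `tensorRestrictsTo_precomp`), and the core gives `R̃(T_k) ≤ (27/4 + δ)^k`. Real proof, no
`sorry` (axioms `propext`, `Classical.choice`, `Quot.sound`). [folklore] -/
theorem tkMinimal_statement_of :
    (∀ (k : ℕ) (S T U : {A : Finset (Fin (3 * k)) // A.card = k}),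
      Literature.Computability.AlgebraicComplexity.kroneckerPow
          (Literature.Computability.AlgebraicComplexity.cwTensor ℂ 1) (3 * k)
          (fun i => if i ∈ S.1 then 0 else 1) (fun i => if i ∈ T.1 then 0 else 1)
          (fun i => if i ∈ U.1 then 0 else 1) =
        if Disjoint S.1 T.1 ∧ Disjoint S.1 U.1 ∧ Disjoint T.1 U.1 then (1 : ℂ) else 0) →
    (∀ δ : ℝ, 0 < δ → ∀ k₀ : ℕ, ∃ k : ℕ, k₀ ≤ k ∧ ∃ m : ℕ, 1 ≤ m ∧
      (Literature.Computability.AlgebraicComplexity.algBorderRank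
          (Literature.Computability.AlgebraicComplexity.kroneckerPow
            (fun a b c : {v : Fin (3 * k) → Fin 2 //
                (Finset.univ.filter fun i => v i = 0).card = k} =>
              Literature.Computability.AlgebraicComplexity.kroneckerPow
                (Literature.Computability.AlgebraicComplexity.cwTensor ℂ 1) (3 * k) a.1 b.1 c.1)
            m) : ℝ) ≤
        ((((27 : ℝ) / 4 + δ) ^ k) ^ m)) →
    ∀ δ : ℝ, 0 < δ → ∀ k₀ : ℕ, ∃ k : ℕ, k₀ ≤ k ∧
      Literature.Computability.AlgebraicComplexity.asymptoticRank
          (fun S T U : {A : Finset (Fin (3 * k)) // A.card = k} =>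
            if Disjoint S.1 T.1 ∧ Disjoint S.1 U.1 ∧ Disjoint T.1 U.1 then (1 : ℂ) else 0) ≤
        ((27 : ℝ) / 4 + δ) ^ k := by
  intro hdict hmil δ hδ k₀
  obtain ⟨k, hk, m, hm, hbR⟩ := hmil δ hδ k₀
  refine ⟨k, hk, ?_⟩
  -- the complement-indicator relabelling `binom([3k],k) → V_k`
  let f : {A : Finset (Fin (3 * k)) // A.card = k} →
      {v : Fin (3 * k) → Fin 2 // (Finset.univ.filter fun i => v i = 0).card = k} :=
    fun S => ⟨fun i => if i ∈ S.1 then 0 else 1, by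
      have hS : (Finset.univ.filter fun i => (if i ∈ S.1 then (0 : Fin 2) else 1) = 0) = S.1 := by
        ext i
        by_cases hi : i ∈ S.1 <;> simp [hi]
      rw [hS]
      exact S.2⟩
  -- `Z_k ≥ T_k` through the dictionary
  have hrestr : TensorRestrictsTo
      (fun a b c : {v : Fin (3 * k) → Fin 2 // (Finset.univ.filter fun i => v i = 0).card = k} =>
        Literature.Computability.AlgebraicComplexity.kroneckerPow
          (Literature.Computability.AlgebraicComplexity.cwTensor ℂ 1) (3 * k) a.1 b.1 c.1)
      (fun S T U : {A : Finset (Fin (3 * k)) // A.card = k} =>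
        if Disjoint S.1 T.1 ∧ Disjoint S.1 U.1 ∧ Disjoint T.1 U.1 then (1 : ℂ) else 0) := by
    have e : (fun S T U : {A : Finset (Fin (3 * k)) // A.card = k} =>
          if Disjoint S.1 T.1 ∧ Disjoint S.1 U.1 ∧ Disjoint T.1 U.1 then (1 : ℂ) else 0) =
        fun S T U =>
          (fun a b c : {v : Fin (3 * k) → Fin 2 // (Finset.univ.filter fun i => v i = 0).card = k} =>
            Literature.Computability.AlgebraicComplexity.kroneckerPow
              (Literature.Computability.AlgebraicComplexity.cwTensor ℂ 1) (3 * k) a.1 b.1 c.1)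
          (f S) (f T) (f U) := by
      funext S T U
      exact (hdict k S T U).symm
    rw [e]
    exact tensorRestrictsTo_precomp _ f f f
  have hr : (0 : ℝ) ≤ ((27 : ℝ) / 4 + δ) ^ k := pow_nonneg (by linarith) k
  exact asymptoticRank_le_of_restrictsTo_of_powMilestone hrestr hr hm hbR

/-- **THE SKELETON THEOREM.** The crux
`Summit.MatrixMultiplication.MatrixMultiplication.Theses.TripartitionBridge.TkMinimal`
(stmt-MatrixMultiplication-6569), concluded BY NAME from the two DECLARED stubs `stub_balancedBlockDictionary`
(dictionary) and `stub_balancedBlockPowerMilestones` (engine) — the only `sorry`s of the file — through the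
sorry-free composition `tkMinimal_statement_of` (the route's `def TkMinimal` unfolds to its conclusion). [folklore] -/
theorem TkMinimal_of :
    Summit.MatrixMultiplication.MatrixMultiplication.Theses.TripartitionBridge.TkMinimal :=
  tkMinimal_statement_of stub_balancedBlockDictionary stub_balancedBlockPowerMilestones

end Summit.MatrixMultiplication.MatrixMultiplication.Cruxes.TkMinimal.Birth

end
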